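import Mathlib
import Summits.ValiantsHypothesis.ValiantsHypothesis.Theorems.RigidityForcesSymmetryRigidMinimalReprStubSliceOpen
import Summits.ValiantsHypothesis.ValiantsHypothesis.Theorems.RigidityForcesSymmetryRigidMinimalReprStubPencilLocInj
import Summits.ValiantsHypothesis.ValiantsHypothesis.Theorems.RigidityForcesSymmetryRankInfRigidToLocallyOpenRankChart

/-!
# Support item `RigidityForcesSymmetry.RankInfRigidToLocallyOpen` (stmt-ValiantsHypothesis-24282) —
# local injectivity on a slice INSIDE THE RANK STRATUM

Route `ValiantsHypothesis/RigidityForcesSymmetry`, sub-crux A2 of crux `RankRigidMinimalRepr` (stmt-18034), the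
rank-constrained slice lemma.  This file is the constrained analogue of the tree's `stub_pencilLocInj`
(`Theorems/RigidityForcesSymmetryRigidMinimalReprStubPencilLocInj.lean`).

**Statement (`rank_pencilLocInj`).**  Let `x₀ = (Λ, A)` be a pencil of size `m` over a finite variable type
`ι` with `det x̃₀ = f ≠ 0`, assume RANK-INFINITESIMAL RIGIDITY (every `B = (Λ', A')` with
`tr(adj(x̃₀)·B̃) = 0` AND `A'_v · ker A_v ⊆ im A_v` for all `v` is a gauge direction `(PΛ − ΛQ, (PA_v − A_vQ)_v)`),
and let `W` be a linear subspace of coefficient space meeting the gauge tangent space `T` only in `0`.  Then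
for `(c, w)` near `(1, 0)` with `w ∈ W`, `det((x₀ + w)~) = c · f` together with `rank (A_v + w_v) ≤ rank A_v`
for all `v` forces `w = 0`.

**Proof.**  As in the unconstrained stub, finitely many evaluation functionals `D_z(B) = tr(adj(x̃₀(z)) B(z))`
and Jacobi's formula control the determinant condition.  The rank condition is encoded by the Schur-type maps
`F_v(w) = Y_v · w_v · (1 + A_v⁺ w_v)⁻¹ · K_v` of the companion file `…RankChart` (`A_v A_v⁺ A_v = A_v`,
`K_v = 1 − A_v⁺A_v`, `Y_v = 1 − A_vA_v⁺`): they VANISH on the rank stratum near `0` (`schurMap_eq_zero`), and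
since `w ↦ Y_v w_v` is linear and vanishes at `0` while the other factor is merely continuous there, `F_v` is
differentiable at `0` with differential `w' ↦ Y_v w'_v K_v` (`hasFDerivAt_bilinear_of_apply_eq_zero` — no derivative
of the matrix inverse is needed), whose kernel consists of rank-tangent directions
(`rankTangent_of_coker_mul_mul_ker_eq_zero`).  Hence the differential of
`Ψ'(c, w) = ((det((x₀ + w)(z)) − c f(z))_{z ∈ S}, (F_v(w))_v)` at `(1, 0)` is injective on `ℂ × W` by the
hypothesis, and an injective differential gives local injectivity (`eventually_eq_of_hasFDerivAt_of_ker_eq_bot`).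
-/

noncomputable section

set_option autoImplicit false

-- the mandated summit-side namespace repeats a component by design (single-problem summit)
set_option linter.dupNamespace false

namespace Summit.ValiantsHypothesis.ValiantsHypothesis.Theorems.RigidityForcesSymmetry.RankSlice

open MvPolynomial Matrix Filter Topology Asymptotics
open scoped Matrix.Norms.Elementwise
open Summit.ValiantsHypothesis.ValiantsHypothesis.Theorems.RigidityForcesSymmetryRigidMinimalRepr

/-! ### A derivative without differentiating: linear-vanishing times continuous -/

section Deriv

/-- If `ℓ` is continuous linear with `ℓ a = 0`, `ψ` is merely CONTINUOUS at `a` and `b` is a bounded bilinear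
map, then `e ↦ b (ℓ e, ψ e)` is differentiable at `a` with derivative `e ↦ b (ℓ e, ψ a)` (no derivative of `ψ`
is needed: the remainder is `b (ℓ (e - a), ψ e - ψ a) = O(‖e - a‖) · o(1)`). -/
theorem hasFDerivAt_bilinear_of_apply_eq_zero {E F G H : Type*}
    [NormedAddCommGroup E] [NormedSpace ℂ E] [NormedAddCommGroup F] [NormedSpace ℂ F]
    [NormedAddCommGroup G] [NormedSpace ℂ G] [NormedAddCommGroup H] [NormedSpace ℂ H]
    {b : F × G → H} (hb : IsBoundedBilinearMap ℂ b) (ℓ : E →L[ℂ] F) {ψ : E → G} {a : E}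
    (hℓ : ℓ a = 0) (hψ : ContinuousAt ψ a) :
    ∃ D : E →L[ℂ] H, HasFDerivAt (fun e => b (ℓ e, ψ e)) D a ∧ ∀ e, D e = b (ℓ e, ψ a) := by
  let D : E →L[ℂ] H := (hb.toContinuousLinearMap.flip (ψ a)).comp ℓ
  have hD : ∀ e, D e = b (ℓ e, ψ a) := fun e => by
    simp [D]
  refine ⟨D, ?_, hD⟩
  refine HasFDerivAt.of_isLittleO ?_
  have hb0 : ∀ z : G, b (0, z) = 0 := fun z => by
    have h := hb.map_sub_left (x := (0 : F)) (y := (0 : F)) (z := z)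
    rw [sub_self, sub_self] at h
    exact h
  have hrem : (fun x' => b (ℓ x', ψ x') - b (ℓ a, ψ a) - D (x' - a)) =
      fun x' => b (ℓ (x' - a), ψ x' - ψ a) := by
    funext x'
    rw [hD, map_sub, hℓ, sub_zero, hb0, sub_zero, hb.map_sub_right]
  rw [hrem]
  have h1 : (fun x' => b (ℓ (x' - a), ψ x' - ψ a)) =O[𝓝 a]
      fun x' => ‖ℓ (x' - a)‖ * ‖ψ x' - ψ a‖ :=
    hb.isBigO_comp (g := fun x' => ℓ (x' - a)) (h := fun x' => ψ x' - ψ a)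
  have h2 : (fun x' => ‖ℓ (x' - a)‖) =O[𝓝 a] fun x' => ‖x' - a‖ :=
    ((ℓ.isBigO_comp (fun x' => x' - a) (𝓝 a)).norm_left).norm_right
  have h3 : (fun x' => ‖ψ x' - ψ a‖) =o[𝓝 a] fun _ => (1 : ℝ) := by
    refine (isLittleO_one_iff ℝ).2 ?_
    have h : Tendsto (fun x' => ψ x' - ψ a) (𝓝 a) (𝓝 0) := by
      rw [← sub_self (ψ a)]
      exact hψ.sub tendsto_const_nhds
    exact tendsto_norm_zero.comp h
  have h4 := h1.trans_isLittleO (h2.mul_isLittleO h3)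
  refine h4.trans_isBigO ?_
  simpa only [mul_one] using (isBigO_refl (fun x' => x' - a) (𝓝 a)).norm_left

end Deriv

/-! ### The constrained local-injectivity statement -/

section Main

/-- **Local injectivity on a slice inside the rank stratum** (constrained `stub_pencilLocInj`).  Near
`(1, 0)`, on a linear slice `W` transverse to the gauge tangent space, `det((x₀ + w)~) = c · f` together with
`rank (A_v + w_v) ≤ rank A_v` for every `v` forces `w = 0`, given RANK-infinitesimal rigidity of
`x₀ = (Λ, A)` and `f ≠ 0`. -/
theorem rank_pencilLocInj (ι : Type) [Fintype ι] (m : ℕ) (f : MvPolynomial ι ℂ)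
    (Λ : Matrix (Fin m) (Fin m) ℂ) (A : ι → Matrix (Fin m) (Fin m) ℂ)
    (W : Submodule ℂ (Matrix (Fin m) (Fin m) ℂ × (ι → Matrix (Fin m) (Fin m) ℂ)))
    (hf : f ≠ 0)
    (hdet : (Λ.map MvPolynomial.C + ∑ v, (MvPolynomial.X v : MvPolynomial ι ℂ) • (A v).map MvPolynomial.C).det
      = f)
    (hT : ∀ (Λ' : Matrix (Fin m) (Fin m) ℂ) (A' : ι → Matrix (Fin m) (Fin m) ℂ),
      ((Λ.map MvPolynomial.C + ∑ v, (MvPolynomial.X v : MvPolynomial ι ℂ) • (A v).map MvPolynomial.C).adjugate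
          * (Λ'.map MvPolynomial.C + ∑ v, (MvPolynomial.X v : MvPolynomial ι ℂ) • (A' v).map MvPolynomial.C)).trace
        = (0 : MvPolynomial ι ℂ) →
      (∀ v w, (A v).mulVec w = 0 → ∃ u, (A' v).mulVec w = (A v).mulVec u) →
      ∃ P Q : Matrix (Fin m) (Fin m) ℂ, Λ' = P * Λ - Λ * Q ∧ ∀ v, A' v = P * A v - A v * Q)
    (hW : ∀ (P Q : Matrix (Fin m) (Fin m) ℂ), ∀ w ∈ W,
      ((P * Λ + Λ * Q, fun v => P * A v + A v * Q) :
          Matrix (Fin m) (Fin m) ℂ × (ι → Matrix (Fin m) (Fin m) ℂ)) = w → w = 0) :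
    ∃ N ∈ 𝓝 ((1 : ℂ), (0 : Matrix (Fin m) (Fin m) ℂ × (ι → Matrix (Fin m) (Fin m) ℂ))),
      ∀ cw ∈ N, cw.2 ∈ W →
        ((Λ + cw.2.1).map MvPolynomial.C +
            ∑ v, (MvPolynomial.X v : MvPolynomial ι ℂ) • (A v + cw.2.2 v).map MvPolynomial.C).det
          = MvPolynomial.C cw.1 * f →
        (∀ v, (A v + cw.2.2 v).rank ≤ (A v).rank) →
        cw.2 = 0 := by
  classical
  -- (0) `{1}`-inverses of the coefficient matrices: `A_v A_v⁺ A_v = A_v`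
  choose Ap hAp using fun v => exists_one_inverse (A v)
  -- (1) evaluation at points `z ∈ ℂ^ι` and the functionals `D_z(B) = tr(adj(x₀(z)) B(z))`
  let ev : (ι → ℂ) →
      ((Matrix (Fin m) (Fin m) ℂ × (ι → Matrix (Fin m) (Fin m) ℂ)) →ₗ[ℂ] Matrix (Fin m) (Fin m) ℂ) := fun z =>
    LinearMap.fst ℂ _ _ + ∑ v, z v • ((LinearMap.proj v).comp (LinearMap.snd ℂ _ _))
  have hev : ∀ z (p : Matrix (Fin m) (Fin m) ℂ × (ι → Matrix (Fin m) (Fin m) ℂ)),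
      ev z p = p.1 + ∑ v, z v • p.2 v := fun z p => by simp [ev]
  let Dz : (ι → ℂ) → ((Matrix (Fin m) (Fin m) ℂ × (ι → Matrix (Fin m) (Fin m) ℂ)) →ₗ[ℂ] ℂ) := fun z =>
    (Matrix.traceLinearMap (Fin m) ℂ ℂ) ∘ₗ (LinearMap.mulLeft ℂ (ev z (Λ, A)).adjugate) ∘ₗ ev z
  have hDz' : ∀ z B, Dz z B = ((ev z (Λ, A)).adjugate * ev z B).trace := fun z B => rfl
  have hDz : ∀ z (B : Matrix (Fin m) (Fin m) ℂ × (ι → Matrix (Fin m) (Fin m) ℂ)),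
      Dz z B = ((Λ + ∑ v, z v • A v).adjugate * (B.1 + ∑ v, z v • B.2 v)).trace := fun z B => by
    rw [hDz', hev, hev]
  have hdetz : ∀ z, (ev z (Λ, A)).det = eval z f := fun z => by
    rw [hev]
    exact (hdet ▸ eval_det_pencil z Λ A).symm
  have hDx₀ : ∀ z, Dz z (Λ, A) = (m : ℂ) * eval z f := fun z => by
    rw [hDz', adjugate_mul, Matrix.trace_smul, trace_one, hdetz, Fintype.card_fin, smul_eq_mul, mul_comm]
  -- (2) finitely many points suffice, plus a point where `f ≠ 0`
  obtain ⟨S₀, hS₀⟩ := exists_finset_forall_mem fun z => LinearMap.ker (Dz z)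
  obtain ⟨z₀, hz₀⟩ : ∃ z₀ : ι → ℂ, eval z₀ f ≠ 0 := by
    by_contra h
    exact hf (MvPolynomial.funext fun z => by
      rw [map_zero]
      exact not_not.1 (not_exists.1 h z))
  let S : Finset (ι → ℂ) := insert z₀ S₀
  -- (3) the key linear algebra: `D_z(w) = γ f(z)` on `S` and `Y_v w_v K_v = 0` for all `v`, with `w ∈ W`,
  --     force `w = 0`, `γ = 0`
  have hkey : ∀ (γ : ℂ) (w : Matrix (Fin m) (Fin m) ℂ × (ι → Matrix (Fin m) (Fin m) ℂ)), w ∈ W →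
      (∀ z ∈ S, Dz z w = γ * eval z f) →
      (∀ v, (1 - A v * Ap v) * w.2 v * (1 - Ap v * A v) = 0) → w = 0 ∧ γ = 0 := by
    intro γ w hw h hrk
    have hw0 : w = 0 := by
      rcases Nat.eq_zero_or_pos m with hm | hm
      · subst hm
        exact Subsingleton.elim _ _
      · have hmC : (m : ℂ) ≠ 0 := Nat.cast_ne_zero.2 hm.ne'
        set B : Matrix (Fin m) (Fin m) ℂ × (ι → Matrix (Fin m) (Fin m) ℂ) :=
          w - (γ / m : ℂ) • ((Λ, A) : Matrix (Fin m) (Fin m) ℂ × (ι → Matrix (Fin m) (Fin m) ℂ)) with hB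
        have hBS : ∀ z ∈ S, Dz z B = 0 := by
          intro z hz
          rw [hB, map_sub, map_smul, h z hz, hDx₀, smul_eq_mul]
          field_simp
          ring
        have hBall : ∀ z, Dz z B = 0 := by
          have hmem := hS₀ B fun z hz => LinearMap.mem_ker.2 (hBS z (Finset.mem_insert_of_mem hz))
          exact fun z => LinearMap.mem_ker.1 (hmem z)
        have hpol : ((Λ.map C + ∑ v, (X v : MvPolynomial ι ℂ) • (A v).map C).adjugate *
            (B.1.map C + ∑ v, (X v : MvPolynomial ι ℂ) • (B.2 v).map C)).trace = 0 :=
          MvPolynomial.funext fun z => by rw [eval_trace_adj_pencil, map_zero, ← hDz]; exact hBall z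
        -- the extra input: `B` is rank-tangent (its `A`-part is `w_v − (γ/m) A_v`, and `Y_v w_v K_v = 0`)
        have hrt : ∀ v w', (A v) *ᵥ w' = 0 → ∃ u, (B.2 v) *ᵥ w' = (A v) *ᵥ u := by
          intro v w' hw'
          obtain ⟨u, hu⟩ := rankTangent_of_coker_mul_mul_ker_eq_zero (hrk v) w' hw'
          refine ⟨u, ?_⟩
          have hB2 : B.2 v = w.2 v - (γ / m : ℂ) • A v := by simp [hB]
          rw [hB2, Matrix.sub_mulVec, Matrix.smul_mulVec, hw', smul_zero, sub_zero, hu]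
        obtain ⟨P, Q, hP1, hP2⟩ := hT B.1 B.2 hpol hrt
        refine hW (P + (γ / m : ℂ) • 1) (-Q) w hw ?_
        have hw1 : w.1 = B.1 + (γ / m : ℂ) • Λ := by simp [hB]
        have hw2 : ∀ v, w.2 v = B.2 v + (γ / m : ℂ) • A v := fun v => by simp [hB]
        refine Prod.ext ?_ (funext fun v => ?_)
        · rw [hw1, hP1]
          simp only [add_mul, smul_mul_assoc, one_mul, mul_neg, sub_eq_add_neg]
          abel
        · show (P + (γ / m : ℂ) • 1) * A v + A v * -Q = w.2 v
          rw [hw2 v, hP2 v]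
          simp only [add_mul, smul_mul_assoc, one_mul, mul_neg, sub_eq_add_neg]
          abel
    refine ⟨hw0, ?_⟩
    have h0 := h z₀ (Finset.mem_insert_self _ _)
    rw [hw0, map_zero] at h0
    exact (mul_eq_zero.1 h0.symm).resolve_right hz₀
  -- (4) the map `Ψ' (c, w) = ((det((x₀ + w)(z)) - c f(z))_{z ∈ S}, (Y_v w_v (1 + A_v⁺ w_v)⁻¹ K_v)_v)`
  --     on `ℂ × W` and its derivative at `(1, 0)`
  let incl : ℂ × W →L[ℂ] (Matrix (Fin m) (Fin m) ℂ × (ι → Matrix (Fin m) (Fin m) ℂ)) :=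
    W.subtypeL.comp (ContinuousLinearMap.snd ℂ ℂ W)
  have hAz : ∀ z : ι → ℂ, HasFDerivAt
      (fun cw : ℂ × W => ev z ((Λ, A) + (cw.2 : Matrix (Fin m) (Fin m) ℂ × (ι → Matrix (Fin m) (Fin m) ℂ))))
      ((LinearMap.toContinuousLinearMap (ev z)).comp incl) (1, 0) := by
    intro z
    have heq : (fun cw : ℂ × W =>
        ev z ((Λ, A) + (cw.2 : Matrix (Fin m) (Fin m) ℂ × (ι → Matrix (Fin m) (Fin m) ℂ)))) =
        fun cw => ev z (Λ, A) + ((LinearMap.toContinuousLinearMap (ev z)).comp incl) cw := by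
      funext cw
      simp [incl, map_add]
    rw [heq]
    exact (ContinuousLinearMap.hasFDerivAt _).const_add _
  choose D hD hDv using fun z : ι → ℂ => hasFDerivAt_det_of_hasFDerivAt (hAz z)
  have hDapply : ∀ z (γ : ℂ) (w : W),
      D z (γ, w) = Dz z (w : Matrix (Fin m) (Fin m) ℂ × (ι → Matrix (Fin m) (Fin m) ℂ)) := by
    intro z γ w
    have e1 : ((Λ, A) : Matrix (Fin m) (Fin m) ℂ × (ι → Matrix (Fin m) (Fin m) ℂ)) +
        ((((1 : ℂ), (0 : W)) : ℂ × W).2 : Matrix (Fin m) (Fin m) ℂ × (ι → Matrix (Fin m) (Fin m) ℂ)) = (Λ, A) := by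
      simp
    rw [hDv, hDz', e1]
    rfl
  have hφ : ∀ s : S, ∃ L : ℂ × W →L[ℂ] ℂ,
      HasFDerivAt (fun cw : ℂ × W => (ev (s : ι → ℂ) ((Λ, A) +
          (cw.2 : Matrix (Fin m) (Fin m) ℂ × (ι → Matrix (Fin m) (Fin m) ℂ)))).det - cw.1 * eval (s : ι → ℂ) f)
        L (1, 0) ∧
      ∀ (γ : ℂ) (w : W), L (γ, w) =
        Dz (s : ι → ℂ) (w : Matrix (Fin m) (Fin m) ℂ × (ι → Matrix (Fin m) (Fin m) ℂ)) - γ * eval (s : ι → ℂ) f := by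
    intro s
    refine ⟨_, (hD (s : ι → ℂ)).fun_sub
      ((ContinuousLinearMap.fst ℂ ℂ W).hasFDerivAt.mul_const (eval (s : ι → ℂ) f)), fun γ w => ?_⟩
    show D (s : ι → ℂ) (γ, w) - (eval (s : ι → ℂ) f) • (ContinuousLinearMap.fst ℂ ℂ W) (γ, w) = _
    rw [hDapply]
    show _ - (eval (s : ι → ℂ) f) • γ = _
    rw [smul_eq_mul, mul_comm]
  choose L₀ hL₀ hL₀v using hφ
  -- the Schur components `F_v = ℓ_v · ψ_v`
  let Lv : ι → (ℂ × W →ₗ[ℂ] Matrix (Fin m) (Fin m) ℂ) := fun v =>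
    (LinearMap.mulLeft ℂ (1 - A v * Ap v)) ∘ₗ (LinearMap.proj v) ∘ₗ
      (LinearMap.snd ℂ (Matrix (Fin m) (Fin m) ℂ) (ι → Matrix (Fin m) (Fin m) ℂ)) ∘ₗ W.subtype ∘ₗ
        (LinearMap.snd ℂ ℂ W)
  have hLv : ∀ v (cw : ℂ × W), Lv v cw =
      (1 - A v * Ap v) * (cw.2 : Matrix (Fin m) (Fin m) ℂ × (ι → Matrix (Fin m) (Fin m) ℂ)).2 v :=
    fun v cw => rfl
  let ℓ : ι → (ℂ × W →L[ℂ] Matrix (Fin m) (Fin m) ℂ) := fun v => LinearMap.toContinuousLinearMap (Lv v)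
  have hℓ : ∀ v (cw : ℂ × W), ℓ v cw =
      (1 - A v * Ap v) * (cw.2 : Matrix (Fin m) (Fin m) ℂ × (ι → Matrix (Fin m) (Fin m) ℂ)).2 v :=
    fun v cw => rfl
  let ψ : ι → (ℂ × W → Matrix (Fin m) (Fin m) ℂ) := fun v cw =>
    (1 + Ap v * (cw.2 : Matrix (Fin m) (Fin m) ℂ × (ι → Matrix (Fin m) (Fin m) ℂ)).2 v)⁻¹ * (1 - Ap v * A v)
  have hψ' : ∀ v (cw : ℂ × W), ψ v cw =
      (1 + Ap v * (cw.2 : Matrix (Fin m) (Fin m) ℂ × (ι → Matrix (Fin m) (Fin m) ℂ)).2 v)⁻¹ * (1 - Ap v * A v) :=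
    fun v cw => rfl
  have hψ0 : ∀ v, ψ v (1, 0) = 1 - Ap v * A v := fun v => by
    rw [hψ']
    simp
  have hcoord : ∀ v, Continuous fun cw : ℂ × W =>
      (cw.2 : Matrix (Fin m) (Fin m) ℂ × (ι → Matrix (Fin m) (Fin m) ℂ)).2 v := fun v =>
    (continuous_apply v).comp (continuous_snd.comp (continuous_subtype_val.comp continuous_snd))
  have hψ : ∀ v, ContinuousAt (ψ v) (1, 0) := by
    intro v
    have hg : Continuous fun cw : ℂ × W =>
        (1 : Matrix (Fin m) (Fin m) ℂ) + Ap v * (cw.2 : Matrix (Fin m) (Fin m) ℂ × (ι → Matrix (Fin m) (Fin m) ℂ)).2 v :=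
      continuous_const.add (continuous_const.mul (hcoord v))
    have hg0 : (1 : Matrix (Fin m) (Fin m) ℂ) +
        Ap v * ((((1 : ℂ), (0 : W)) : ℂ × W).2 : Matrix (Fin m) (Fin m) ℂ × (ι → Matrix (Fin m) (Fin m) ℂ)).2 v
          = 1 := by
      simp
    have hinv : ContinuousAt (fun cw : ℂ × W =>
        ((1 : Matrix (Fin m) (Fin m) ℂ) +
          Ap v * (cw.2 : Matrix (Fin m) (Fin m) ℂ × (ι → Matrix (Fin m) (Fin m) ℂ)).2 v)⁻¹) (1, 0) := by
      refine ContinuousAt.comp (g := Inv.inv) ?_ hg.continuousAt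
      rw [hg0]
      refine continuousAt_matrix_inv _ ?_
      rw [det_one]
      have h1 := NormedRing.inverse_continuousAt (1 : ℂˣ)
      rw [Units.val_one] at h1
      exact h1
    exact hinv.mul continuousAt_const
  have hℓ0 : ∀ v, ℓ v (1, 0) = 0 := fun v => by
    rw [hℓ]
    simp
  have hB := SliceOpen.isBoundedBilinearMap_matrix_mul (m := m)
  choose Dv hDv hDvv using fun v => hasFDerivAt_bilinear_of_apply_eq_zero hB (ℓ v) (hℓ0 v) (hψ v)
  have hΨ : HasFDerivAt
      (fun cw : ℂ × W =>
        ((fun s : S => (ev (s : ι → ℂ) ((Λ, A) +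
            (cw.2 : Matrix (Fin m) (Fin m) ℂ × (ι → Matrix (Fin m) (Fin m) ℂ)))).det - cw.1 * eval (s : ι → ℂ) f),
          fun v => ℓ v cw * ψ v cw))
      ((ContinuousLinearMap.pi L₀).prod (ContinuousLinearMap.pi Dv)) (1, 0) :=
    (hasFDerivAt_pi.2 hL₀).prodMk (hasFDerivAt_pi.2 hDv)
  -- (5) the differential is injective, so `Ψ'` is locally injective at `(1, 0)`
  set Lt := (ContinuousLinearMap.pi L₀).prod (ContinuousLinearMap.pi Dv) with hLt_def
  have hker : LinearMap.ker Lt.toLinearMap = ⊥ := by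
    refine LinearMap.ker_eq_bot'.2 fun cw hcw => ?_
    obtain ⟨γ, w⟩ := cw
    rw [ContinuousLinearMap.coe_coe, hLt_def, ContinuousLinearMap.prod_apply, Prod.mk_eq_zero] at hcw
    obtain ⟨hcw1, hcw2⟩ := hcw
    have h : ∀ z ∈ S, Dz z (w : Matrix (Fin m) (Fin m) ℂ × (ι → Matrix (Fin m) (Fin m) ℂ)) = γ * eval z f := by
      intro z hz
      have hz' := congrFun hcw1 ⟨z, hz⟩
      simp only [ContinuousLinearMap.pi_apply, Pi.zero_apply, hL₀v] at hz'
      exact sub_eq_zero.1 hz'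
    have hrk : ∀ v, (1 - A v * Ap v) * (w : Matrix (Fin m) (Fin m) ℂ × (ι → Matrix (Fin m) (Fin m) ℂ)).2 v *
        (1 - Ap v * A v) = 0 := by
      intro v
      have hv : Dv v (γ, w) = 0 := by
        have hv' := congrFun hcw2 v
        rw [ContinuousLinearMap.pi_apply, Pi.zero_apply] at hv'
        exact hv'
      rw [hDvv, hψ0] at hv
      exact hv
    obtain ⟨hw0, hγ0⟩ := hkey γ w w.2 h hrk
    rw [hγ0, (Submodule.coe_eq_zero.1 hw0 : w = 0)]
    rfl
  have hEv := eventually_eq_of_hasFDerivAt_of_ker_eq_bot hΨ hker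
  -- (6) the neighbourhood: a metric ball of the same radius in `ℂ × X`, cut by `det (1 + A_v⁺ w_v) ≠ 0`
  obtain ⟨ε, hε, hball⟩ := Metric.eventually_nhds_iff.1 hEv
  have hdetne : ∀ᶠ cw in 𝓝 ((1 : ℂ), (0 : Matrix (Fin m) (Fin m) ℂ × (ι → Matrix (Fin m) (Fin m) ℂ))),
      ∀ v, (1 + Ap v * cw.2.2 v).det ≠ 0 := by
    refine eventually_all.2 fun v => ?_
    have hc : Continuous fun cw : ℂ × (Matrix (Fin m) (Fin m) ℂ × (ι → Matrix (Fin m) (Fin m) ℂ)) =>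
        (1 + Ap v * cw.2.2 v).det :=
      (continuous_const.add (continuous_const.mul
        ((continuous_apply v).comp (continuous_snd.comp continuous_snd)))).matrix_det
    exact hc.continuousAt.eventually_ne (by simp)
  refine ⟨Metric.ball ((1 : ℂ), (0 : Matrix (Fin m) (Fin m) ℂ × (ι → Matrix (Fin m) (Fin m) ℂ))) ε ∩
      {cw | ∀ v, (1 + Ap v * cw.2.2 v).det ≠ 0},
    inter_mem (Metric.ball_mem_nhds _ hε) hdetne, fun cw hcw hcW hdet' hrank => ?_⟩
  obtain ⟨hcw, hcwdet⟩ := hcw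
  have hdist : dist ((cw.1, ⟨cw.2, hcW⟩) : ℂ × W) (1, 0) < ε := by
    rw [Metric.mem_ball] at hcw
    calc dist ((cw.1, ⟨cw.2, hcW⟩) : ℂ × W) (1, 0) = dist cw (1, 0) := by
          simp [Prod.dist_eq]
      _ < ε := hcw
  have h1 := hball hdist
  -- `Ψ' (c, w) = Ψ' (1, 0)`: determinant part by `det = c f`, Schur part by `schurMap_eq_zero`
  have h2 :
      ((fun s : S => (ev (s : ι → ℂ) ((Λ, A) +
          ((⟨cw.2, hcW⟩ : W) : Matrix (Fin m) (Fin m) ℂ × (ι → Matrix (Fin m) (Fin m) ℂ)))).det -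
            cw.1 * eval (s : ι → ℂ) f),
        fun v => ℓ v (cw.1, ⟨cw.2, hcW⟩) * ψ v (cw.1, ⟨cw.2, hcW⟩)) =
      ((fun s : S => (ev (s : ι → ℂ) ((Λ, A) +
          ((((1 : ℂ), (0 : W)) : ℂ × W).2 : Matrix (Fin m) (Fin m) ℂ × (ι → Matrix (Fin m) (Fin m) ℂ)))).det -
            (((1 : ℂ), (0 : W)) : ℂ × W).1 * eval (s : ι → ℂ) f),
        fun v => ℓ v ((1 : ℂ), (0 : W)) * ψ v ((1 : ℂ), (0 : W))) := by
    refine Prod.ext (funext fun s => ?_) (funext fun v => ?_)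
    · have hl : (ev (s : ι → ℂ) ((Λ, A) + cw.2)).det = cw.1 * eval (s : ι → ℂ) f := by
        have := congrArg (eval (s : ι → ℂ)) hdet'
        rw [eval_det_pencil, map_mul, eval_C] at this
        rw [hev]
        exact this
      simp only [ZeroMemClass.coe_zero, add_zero, hdetz, one_mul, sub_self]
      rw [hl, sub_self]
    · show ℓ v (cw.1, ⟨cw.2, hcW⟩) * ψ v (cw.1, ⟨cw.2, hcW⟩) = ℓ v ((1 : ℂ), (0 : W)) * ψ v ((1 : ℂ), (0 : W))
      rw [hℓ0, Matrix.zero_mul, hℓ, hψ', ← Matrix.mul_assoc]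
      exact schurMap_eq_zero (hAp v) (isUnit_iff_ne_zero.2 (hcwdet v)) (hrank v)
  have h3 := h1 h2
  have h4 := congrArg (fun x : ℂ × W => (x.2 : Matrix (Fin m) (Fin m) ℂ × (ι → Matrix (Fin m) (Fin m) ℂ))) h3
  simpa using h4

end Main

end Summit.ValiantsHypothesis.ValiantsHypothesis.Theorems.RigidityForcesSymmetry.RankSlice

end
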